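import Summits.QuantumFields.YangMills.Theorems.AllWindowsColdBoxBoxHighLineEdgeChartPolynomial

/-!
# T-S5 Wick layer, part 4 — the TWO-VERTEX BOUND: colour-distinct vertices only cross-contract, so a pair of `k`-leg vertices is bounded by
# `Z·(2k−1)!!·M^k` with `M` the largest CROSS propagator (the «triple bond» of T-S5.12a, `k = 3`)

Planner ym-idea-2 g18's `STUB-PLAN-S5-STEP2.md` §3–§4: the cubic vertex `V₃` has COLOUR-ε STRUCTURE — within one vertex the three colour indices are
pairwise distinct — so under the colour-diagonal propagator `S_L((e,c),(e',c')) = (2β)⁻¹·[c = c']·(L⁻¹)_{ee'}` (✓EdgeChartWick) every intra-vertex contraction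
vanishes and `E₀[V₃²]` is a sum of «triple bonds» `≲ β²·(2β)⁻³·Σ_{p,p'} |G(p,p')|³` (12a: `E₀[V₃²] ≲ β⁻¹H⁴·polylog`).  This file supplies the abstract step:

* §1 `pairingSum_mono'` / `abs_pairingSum_le_doubleFactorial'` — the crude pairing bounds of ✓EdgeChartWick with hypotheses only on DISTINCT legs `i ≠ j`
  (a pairing never pairs a leg with itself);
* §2 `inv_apply_comm` / `propagator_comm` — `L⁻¹` and `S_L` are symmetric for positive-definite `L`;
* §3 ★`abs_integral_twoVertex_le` — for leg families `legA : Fin m → I × Fin 3`, `legB : Fin m' → I × Fin 3` (`m + m' = 2k` via `e : Fin m ⊕ Fin m' ≃ Fin 2k`)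
  with pairwise-distinct colours inside each family and `|S_L(legA i, legB j)| ≤ M` across:
  `|∫ (∏ a_{legA}) (∏ a_{legB}) e^{−βQ} da| ≤ Z·(2k−1)!!·M^k`; cold-box corollary `coldBox_abs_integral_twoVertex_le` with ✓S3b's
  `M = (2β)⁻¹·C(1+log H)/(1+d_min)²` is left to the 12a assembly (it only instantiates `M`).

Tree (✓EdgeChartPolynomial) + Mathlib; no definitions.  HONEST LABEL: bookkeeping for STEP 2 of the XL stub S5 of a critic-PASSed DRAFT line; T-S5.7/10/12/13, S5, U5,
⟨24004⟩ ⟨24335⟩ ⟨24336⟩ remain OPEN; route AllWindowsColdBox is DRAFT; no rung is proved; the Yang–Mills mass gap is NOT proved by this file.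
Seat ym-line-sfw-p2 g77 (LEAD, cell ym-idea-1; Wick layer T-S5.10/11/12a).
-/

set_option autoImplicit false

noncomputable section

open MeasureTheory Matrix Finset
open scoped Kronecker Nat
open Literature.Probability.LatticeModels (pairingSum pairIdx pairingSum_congr_of_eq)

namespace Summit.QuantumFields.YangMills.Theorems.AllWindowsColdBoxBoxHighLine

namespace EdgeChartGaussian

open LaplaceSandwich (flatten flatten_apply volume_preserving_flatten)
open GaussianChartWick

/-! ## §1 Crude pairing bounds with hypotheses on distinct legs only -/

section Pairing

variable {α : Type*}

/-- The two legs of one pair of an ordering are distinct indices. -/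
theorem perm_pairIdx_ne (k : ℕ) (τ : Equiv.Perm (Fin (2 * k))) (j : Fin k) :
    τ (pairIdx k (j, 0)) ≠ τ (pairIdx k (j, 1)) := by
  intro h
  have h' := (pairIdx k).injective (τ.injective h)
  simp only [Prod.mk.injEq, Fin.zero_eq_one_iff, OfNat.ofNat_ne_one, and_false] at h'

/-- Monotonicity with hypotheses on distinct legs: `0 ≤ S ≤ S'` on pairs of distinct legs ⇒ `𝒢_k[S](x) ≤ 𝒢_k[S'](x)`. -/
theorem pairingSum_mono' {S S' : α → α → ℝ} (k : ℕ) (x : Fin (2 * k) → α) (h0 : ∀ i j, i ≠ j → 0 ≤ S (x i) (x j))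
    (h : ∀ i j, i ≠ j → S (x i) (x j) ≤ S' (x i) (x j)) : pairingSum S k x ≤ pairingSum S' k x := by
  unfold pairingSum
  refine mul_le_mul_of_nonneg_left (Finset.sum_le_sum fun τ _ => ?_) (by positivity)
  exact Finset.prod_le_prod (fun j _ => h0 _ _ (perm_pairIdx_ne k τ j)) fun j _ => h _ _ (perm_pairIdx_ne k τ j)

/-- `𝒢_k[|S|] ≤ (2k−1)!!·B^k` when `|S| ≤ B` on pairs of distinct legs. -/
theorem pairingSum_abs_le_doubleFactorial' (S : α → α → ℝ) (k : ℕ) (x : Fin (2 * k) → α) {B : ℝ}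
    (hB : ∀ i j, i ≠ j → |S (x i) (x j)| ≤ B) : pairingSum (fun a b => |S a b|) k x ≤ ((2 * k - 1)‼ : ℕ) * B ^ k := by
  rw [← pairingSum_const_kernel B k x]
  exact pairingSum_mono' k x (fun i j _ => abs_nonneg _) hB

/-- ★ **Crude Wick bound, distinct-leg form**: `|S(x_i,x_j)| ≤ B` for `i ≠ j` ⇒ `|𝒢_k[S](x)| ≤ (2k−1)!!·B^k`. -/
theorem abs_pairingSum_le_doubleFactorial' (S : α → α → ℝ) (k : ℕ) (x : Fin (2 * k) → α) {B : ℝ}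
    (hB : ∀ i j, i ≠ j → |S (x i) (x j)| ≤ B) : |pairingSum S k x| ≤ ((2 * k - 1)‼ : ℕ) * B ^ k :=
  (abs_pairingSum_le S k x).trans (pairingSum_abs_le_doubleFactorial' S k x hB)

end Pairing

/-! ## §2 Symmetry of the propagator -/

variable {I : Type} [Fintype I] [DecidableEq I]

/-- `L⁻¹` is symmetric for a positive-definite (hence symmetric) real matrix `L`. -/
theorem inv_apply_comm (L : Matrix I I ℝ) (hL : L.PosDef) (e e' : I) : L⁻¹ e e' = L⁻¹ e' e := by
  have hT : Lᵀ = L := by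
    have h := hL.isHermitian.eq
    rwa [Matrix.conjTranspose_eq_transpose_of_trivial] at h
  rw [← Matrix.transpose_apply L⁻¹ e' e, Matrix.transpose_nonsing_inv, hT]

/-- The colour-diagonal propagator is symmetric. -/
theorem propagator_comm (L : Matrix I I ℝ) (hL : L.PosDef) (β : ℝ) (p q : I × Fin 3) :
    ((2 * β)⁻¹ * if p.2 = q.2 then L⁻¹ p.1 q.1 else 0) = (2 * β)⁻¹ * if q.2 = p.2 then L⁻¹ q.1 p.1 else 0 := by
  by_cases h : p.2 = q.2
  · rw [if_pos h, if_pos h.symm, inv_apply_comm L hL]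
  · rw [if_neg h, if_neg (Ne.symm h)]

/-- The partition function `Z = √(π/β)^{|I×Fin 3|}/√det(L ⊗ₖ 1)` is positive. -/
theorem partitionConst_pos (L : Matrix I I ℝ) (hL : L.PosDef) {β : ℝ} (hβ : 0 < β) :
    0 < Real.sqrt (Real.pi / β) ^ Fintype.card (I × Fin 3) / Real.sqrt (L ⊗ₖ (1 : Matrix (Fin 3) (Fin 3) ℝ)).det :=
  div_pos (pow_pos (Real.sqrt_pos.2 (div_pos Real.pi_pos hβ)) _)
    (Real.sqrt_pos.2 (posDef_kronecker_one (o := Fin 3) L hL).det_pos)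

/-! ## §3 The two-vertex bound -/

/-- ★ **Two-vertex bound.**  Two leg families with pairwise-distinct colours inside each family only cross-contract; if every cross propagator
is at most `M` in absolute value then `|∫ (∏ a_{legA})(∏ a_{legB}) e^{−βQ} da| ≤ Z · (2k−1)!! · M^k` (`m + m' = 2k`). -/
theorem abs_integral_twoVertex_le (L : Matrix I I ℝ) (hL : L.PosDef) {β : ℝ} (hβ : 0 < β) {m m' k : ℕ}
    (e : Fin m ⊕ Fin m' ≃ Fin (2 * k)) (legA : Fin m → I × Fin 3) (legB : Fin m' → I × Fin 3)
    (hA : ∀ i j, i ≠ j → (legA i).2 ≠ (legA j).2) (hB : ∀ i j, i ≠ j → (legB i).2 ≠ (legB j).2) {M : ℝ} (hM : 0 ≤ M)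
    (hAB : ∀ i j, |(2 * β)⁻¹ * (if (legA i).2 = (legB j).2 then L⁻¹ (legA i).1 (legB j).1 else 0)| ≤ M) :
    |∫ a : I → EuclideanSpace ℝ (Fin 3), (∏ s, a ((Sum.elim legA legB) s).1 ((Sum.elim legA legB) s).2) *
        Real.exp (-(β * ∑ c : Fin 3, (fun e => a e c) ⬝ᵥ (L *ᵥ fun e => a e c)))| ≤
      Real.sqrt (Real.pi / β) ^ Fintype.card (I × Fin 3) / Real.sqrt (L ⊗ₖ (1 : Matrix (Fin 3) (Fin 3) ℝ)).det *
        (((2 * k - 1)‼ : ℕ) * M ^ k) := by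
  have hZ := partitionConst_pos L hL hβ
  rw [integral_prodCoord_fintype_eq_pairingSum L hL hβ e, abs_mul, abs_of_pos hZ]
  refine mul_le_mul_of_nonneg_left (abs_pairingSum_le_doubleFactorial' _ k _ fun i j hij => ?_) hZ.le
  have hij' : e.symm i ≠ e.symm j := fun h => hij (e.symm.injective h)
  have hzero : |(2 * β)⁻¹ * (0 : ℝ)| ≤ M := by rw [mul_zero, abs_zero]; exact hM
  simp only [Function.comp_apply]
  rcases hi : e.symm i with i' | i' <;> rcases hj : e.symm j with j' | j' <;> rw [hi, hj] at hij' <;>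
    simp only [Sum.elim_inl, Sum.elim_inr]
  · rw [if_neg (hA i' j' fun h => hij' (congrArg Sum.inl h))]; exact hzero
  · exact hAB i' j'
  · rw [← propagator_comm L hL]; exact hAB j' i'
  · rw [if_neg (hB i' j' fun h => hij' (congrArg Sum.inr h))]; exact hzero

/-- The `k = 3` instance («triple bond»): two colour-distinct cubic vertices, `|∫ M_A M_B e^{−βQ}| ≤ Z · 15 · M³`. -/
theorem abs_integral_twoCubic_le (L : Matrix I I ℝ) (hL : L.PosDef) {β : ℝ} (hβ : 0 < β)
    (legA legB : Fin 3 → I × Fin 3)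
    (hA : ∀ i j, i ≠ j → (legA i).2 ≠ (legA j).2) (hB : ∀ i j, i ≠ j → (legB i).2 ≠ (legB j).2) {M : ℝ} (hM : 0 ≤ M)
    (hAB : ∀ i j, |(2 * β)⁻¹ * (if (legA i).2 = (legB j).2 then L⁻¹ (legA i).1 (legB j).1 else 0)| ≤ M) :
    |∫ a : I → EuclideanSpace ℝ (Fin 3), (∏ s, a ((Sum.elim legA legB) s).1 ((Sum.elim legA legB) s).2) *
        Real.exp (-(β * ∑ c : Fin 3, (fun e => a e c) ⬝ᵥ (L *ᵥ fun e => a e c)))| ≤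
      Real.sqrt (Real.pi / β) ^ Fintype.card (I × Fin 3) / Real.sqrt (L ⊗ₖ (1 : Matrix (Fin 3) (Fin 3) ℝ)).det * (15 * M ^ 3) := by
  have h := abs_integral_twoVertex_le L hL hβ (m := 3) (m' := 3) (k := 3)
    (finSumFinEquiv.trans (finCongr (show 3 + 3 = 2 * 3 by norm_num))) legA legB hA hB hM hAB
  have h15 : ((2 * 3 - 1)‼ : ℕ) = 15 := by decide
  rw [h15] at h
  exact_mod_cast h

/-- In particular the product of two colour-distinct monomials, in the `(∏ A)·(∏ B)` form used by `integral_sumProd_mul_sumProd`. -/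
theorem abs_integral_prod_mul_prod_le (L : Matrix I I ℝ) (hL : L.PosDef) {β : ℝ} (hβ : 0 < β) {m m' k : ℕ}
    (e : Fin m ⊕ Fin m' ≃ Fin (2 * k)) (legA : Fin m → I × Fin 3) (legB : Fin m' → I × Fin 3)
    (hA : ∀ i j, i ≠ j → (legA i).2 ≠ (legA j).2) (hB : ∀ i j, i ≠ j → (legB i).2 ≠ (legB j).2) {M : ℝ} (hM : 0 ≤ M)
    (hAB : ∀ i j, |(2 * β)⁻¹ * (if (legA i).2 = (legB j).2 then L⁻¹ (legA i).1 (legB j).1 else 0)| ≤ M) :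
    |∫ a : I → EuclideanSpace ℝ (Fin 3), (∏ i, a (legA i).1 (legA i).2) * (∏ j, a (legB j).1 (legB j).2) *
        Real.exp (-(β * ∑ c : Fin 3, (fun e => a e c) ⬝ᵥ (L *ᵥ fun e => a e c)))| ≤
      Real.sqrt (Real.pi / β) ^ Fintype.card (I × Fin 3) / Real.sqrt (L ⊗ₖ (1 : Matrix (Fin 3) (Fin 3) ℝ)).det *
        (((2 * k - 1)‼ : ℕ) * M ^ k) := by
  simp_rw [prodCoord_mul_prodCoord]
  exact abs_integral_twoVertex_le L hL hβ e legA legB hA hB hM hAB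

end EdgeChartGaussian

end Summit.QuantumFields.YangMills.Theorems.AllWindowsColdBoxBoxHighLine

end
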